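import Mathlib
import HarnessLib
import Summits.Ventures.LatticeQCDFlow.Exactness.CabibboMarinariORSweep

/-!
# The TRUE link heat bath followed by over-relaxation sweeps converges to the `SU(N)` Wilson measure from every start (the engine's `SU(2)` path: Creutz / Kennedy–Pendleton heat bath + OR)

HONEST FRAMING: exact (Metropolis-corrected) sampling algorithms for lattice gauge theory;
figures of merit are autocorrelation/cost numbers at stated couplings and volumes; no
continuum-physics claim.

Venture `LatticeQCDFlow` (cell pub-lqcd), topic `Exactness`, FANOUT row 9 (eng-latcore, the
engine `latflow.core.updates.composite_sweep(f, β, 'hb', n_or)` for `SU(2)`: the single-link heat bath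
IS the exact conditional redraw — Creutz 1980 / Kennedy–Pendleton 1985, typed from the uniforms up in
`SU2HeatBathFromUniforms.lean` — followed by `n_or` over-relaxation sweeps `U ↦ ŝ U† ŝ`).  NEW WORK
of the cell: the composition of gen-9's `WilsonHeatBathErgodic.wilson_heatBathSweep_comp_uniformlyErgodic`
(the exact single-link heat-bath sweep followed by ANY exact Markov kernel converges from every start)
with gen-17's `CabibboMarinariORSweep.cmORSweep_invariant` (every OR schedule is exact for
`e^{−βS_W}·Haar^{⊗E}`, `L ≥ 2`; for `N = 2` the single frame `Fin 2 ≃ Fin 2 ⊕ Fin 0` is the plain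
`SU(2)` over-relaxation).  Nothing is cited as a fact.

* `wilsonWeight_eq_withDensity_gibbsDensity` — the Literature's `wilsonWeight ρ β` is
  `Haar^{⊗E}` with density `gibbsDensity (β S_W)` (rewriting `−β·S = −(β·S)`);
* **`wilson_heatBath_orSweep_uniformlyErgodic`** — for the torus `(ℤ/L)^d`, `L ≥ 2`, `SU(N)` in the
  defining representation, any real `β`, any scan of exact single-link heat baths visiting every link,
  followed by ANY over-relaxation schedule (links × subgroup frames): `∃ ε ∈ (0, 1]`,
  `|μ₀Kᵗ(A) − μ_{Λ,β}(A)| ≤ (1 − ε)ᵗ` for every initial law, `t`, `A`.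

NOT CLAIMED: `'metro' + 'or'`; rates; floating point; `L = 1`.
-/

noncomputable section

namespace Summit.Ventures.LatticeQCDFlow.Exactness

open MeasureTheory ProbabilityTheory
open Literature.MathematicalPhysics.QuantumFieldTheory
open scoped ENNReal

section HBOR

variable {d L N : ℕ} [NeZero L] {m : Type*} [Fintype m] [DecidableEq m]

/-- The Literature's Wilson weight is `Haar^{⊗E}` with density `gibbsDensity (β·S_W)`. -/
theorem wilsonWeight_eq_withDensity_gibbsDensity (β : ℝ) :
    wilsonWeight (d := d) (L := L) (suRep N) β =
      (Measure.pi (linkHaar (Edge d L) (Fin N))).withDensity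
        (gibbsDensity fun U : GaugeConfig d L (Matrix.specialUnitaryGroup (Fin N) ℂ) =>
          β * wilsonAction (suRep N) U) := by
  have hdens : (fun U : GaugeConfig d L (Matrix.specialUnitaryGroup (Fin N) ℂ) =>
        ENNReal.ofReal (Real.exp (-β * wilsonAction (suRep N) U))) =
      gibbsDensity fun U : GaugeConfig d L (Matrix.specialUnitaryGroup (Fin N) ℂ) =>
        β * wilsonAction (suRep N) U := by
    funext U
    rw [gibbsDensity, neg_mul]
  rw [wilsonWeight, hdens]

/-- **THE EXACT LINK HEAT-BATH SWEEP FOLLOWED BY ANY OVER-RELAXATION SCHEDULE CONVERGES TO THE WILSON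
MEASURE FROM EVERY START** (`SU(N)` in the defining representation, `L ≥ 2`, any real `β`; for
`N = 2` this is the engine's `'hb' + n_or × 'or'` path with the Creutz/Kennedy–Pendleton heat bath). -/
theorem wilson_heatBath_orSweep_uniformlyErgodic (hL : 2 ≤ L) (β : ℝ) {l : List (Edge d L)}
    (hl : ∀ e, e ∈ l) (sched : List (Edge d L × (Fin N ≃ Fin 2 ⊕ m))) :
    ∃ ε : ℝ, 0 < ε ∧ ε ≤ 1 ∧ ∀ (μ₀ : Measure (GaugeConfig d L (Matrix.specialUnitaryGroup (Fin N) ℂ)))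
      [IsProbabilityMeasure μ₀] (t : ℕ) (A : Set (GaugeConfig d L (Matrix.specialUnitaryGroup (Fin N) ℂ))),
      |((fun ν : Measure (GaugeConfig d L (Matrix.specialUnitaryGroup (Fin N) ℂ)) =>
          ν.bind (cmORSweep sched ∘ₖ cycle (l.map (siteHeatBath
            (fun _ : Edge d L => haarProbability (Matrix.specialUnitaryGroup (Fin N) ℂ))
            (gibbsDensity fun U : GaugeConfig d L (Matrix.specialUnitaryGroup (Fin N) ℂ) =>
              β * wilsonAction (suRep N) U)))))^[t] μ₀).real A
          - (wilsonMeasure (suRep N) β).real A| ≤ (1 - ε) ^ t := by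
  have hη : Kernel.Invariant (cmORSweep (d := d) (L := L) sched) (wilsonWeight (d := d) (L := L) (suRep N) β) := by
    rw [wilsonWeight_eq_withDensity_gibbsDensity]
    exact cmORSweep_invariant β hL sched
  exact wilson_heatBathSweep_comp_uniformlyErgodic (suRep N) continuous_suRep β hl (cmORSweep sched) hη

end HBOR

end Summit.Ventures.LatticeQCDFlow.Exactness
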